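import Summits.QuantumFields.BalabanUV.T4Continuum.Support.NE7MinimiserTensionPairing
import Summits.QuantumFields.BalabanUV.T4Continuum.Support.NE7ExactCurrent
import Summits.QuantumFields.BalabanUV.T4Continuum.Support.NE3SmoothLiftW
import Summits.QuantumFields.BalabanUV.T4Continuum.Support.AveragingDeficitMultiLevelBridge
import Summits.QuantumFields.BalabanUV.T4Continuum.Support.NE3DressedBlockField
import Summits.QuantumFields.BalabanUV.T4Continuum.Support.NE3StraightAverageSplit
import HarnessLib

/-!
# NE7ExactCurrentQbarKernel — THE EXACT FIRST VARIATION OF AN INTERIOR CONSTRAINED MINIMISER ANNIHILATES THE KERNEL OF THE EXACT STRAIGHT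
# PART `QbarIter` OF THE LINEARISED k-FOLD AVERAGE (hypothesis `hτS` of (E3‴) `NE7TensionKernelPerturbed.normSq_le_of_exact_annihilator_near`):
# «the Lagrange multiplier of the constrained minimiser is a COARSE 1-FORM and its gauge part drops out»

Cell `pub-balaban`, rung (B)+1 sub-cell t4, lineage `b2b-balaban-t4-ne7-p1`, generation 63 (CRUX PROVER NE7 #1, ruling e34b3e0c (2)); hunt (h7)
«ENERGY ROAD», memo v2 §6, identification step (h7-e).  THE ARGUMENT (all inputs BY NAME).  Let `U` be a `(j+2)`-level constrained minimiser of
`sfClass d L N ε` that is INTERIOR (`SmallField U a`, `a < ε(L^{j+2})^{−2}` — (8), a hypothesis) in the class `LevelSmall d L (j+1) (ε(L^{j+2})^{−2})`, and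
`ψ` a skew `N·L^{j+2}`-periodic direction with `QbarIter L (j+2) U ψ = 0`.  By the NE3 swarm's COVARIANT STRUCTURE THEOREM
(`NE3TangentCovariantTower.dirIter_eq_QbarIter_add_gaugeDir`) the full linearised average of `ψ` is then a COARSE GAUGE DIRECTION,
`dirIter L (j+2) U ψ = gaugeDir (cavgIter L (j+2) U) (framePotW L (j+2) U ψ)`; the generator `framePotW … ψ` is skew and `N`-periodic
(`NE3SmoothLiftW.framePotW_skew` ∕ `framePotW_add_period`), so its pull-back `λ = framePotW ψ ∘ cdiv (L^{j+2})` to the fine lattice is a skew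
`N·L^{j+2}`-periodic fine generator whose pure gauge direction `gaugeDir U λ` has THE SAME linearised average (`dirIter_gaugeDir`, exact gauge
covariance of Bałaban's (42)); by additivity (`dirIter_add`) `ψ − gaugeDir U λ` is TANGENT to the fibre (`tangentIter_iff_dirIter_eq_zero`), hence
(gen 62 `NE7MinimiserTensionPairing.critical_of_interior_isMinimiser`, the tree's multi-level criticality) the Wilson action is critical along it:
`dAction U (ψ − gaugeDir U λ) = 0` (`NE7ExactCurrent.dAction_eq_zero_of_critical`); and `dAction U (gaugeDir U λ) = 0` EXACTLY
(`NE3PureGaugeFirstVariation.dAction_gaugeDir`).  Hence **`dAction_eq_zero_of_QbarIter_eq_zero`**: `dAction U ψ (plaqsOf (periodBox (N·L^{j+2}))) = 0`,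
and its torus form **`exactCurrent_eq_zero_of_QbarIter_eq_zero`** for the exact current `τ` of `NE7ExactCurrent` (`τ b = dAction U (extF b) …`):
`τ b = 0` for every torus 1-form `b` with skew extension in `ker QbarIter`.  This is `hτS` of (E3‴) for `S = QbarIter` read on the skew forms; the
`K`-splitting `hSK` is then automatic once `S` is taken on the skew forms (`K = ⊤`).
WHAT REMAINS for (H∃)ᵀ after this file: the CLM packaging of `M^d•Ad∘QbarIter` on the skew torus forms and the op-norm bound
`‖M^d•Ad∘QbarIter − TWc‖ ≤ √λ′∕8` from the NE3 C1 tower (`NE3CovariantLineSumsL2TowerSharp`, `NE3CombVsTowerEnd` — with the tower error sharpened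
by its smallness factor), and (8) interiority.
HONEST FRAMING (page 1): re-assembly of accepted tree theorems at ONE interior constrained minimiser on a FIXED FINITE torus, rung (B)+1; interiority
(8) is ASSUMED; NE7, NE3 NOT PRINTED in [Balaban1984PropagatorsI]–[Balaban1989LargeFieldII] and NOT PROVED; continuum YM on T⁴ ⇐ BetaPertH ∧ nine
spine estimates (0/9 proved); BetaPertH ⇐ (D1) ∧ (D4) ∧ CAP+tail; G-an2-4 gates asym, D1 and NE2/3/4; NOT infinite volume, NOT mass gap, NOT Clay.
0 def, 0 sorry.
-/

set_option autoImplicit false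

open scoped BigOperators Matrix Matrix.Norms.L2Operator
open Finset

namespace Summit.QuantumFields.BalabanUV.T4Continuum.NE7ExactCurrentQbarKernel

open Literature.MathematicalPhysics.QuantumFieldTheory.Balaban1983to89
open B7Prop1Explicit B7Prop2Explicit MatrixNorms UnitaryModel
open T4AveragingDeficitWall (IsUnitaryCfg IsSkewDir SmallField fineAction vary)
open T4AveragingDeficitWallBoundary (periodBox IsPeriodicCfg)
open AveragingDeficitPeriodicCounting (IsPeriodicDir)
open AveragingDeficitChartCalculus (cavg)
open AveragingDeficitMultiLevelPrep (cpush TangentIter cavgIter tower LevelSmall)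
open AveragingDeficitMultiLevelBridge (tower_eq)
open BlockAveragePushDirGauge (gaugeDir isPeriodicDir_gaugeDir)
open NE3HessShapes (plaqsOf)
open NE3HessForm (dAction)
open NE3PureGaugeFirstVariation (dAction_gaugeDir)
open NE3TangentCovariantTower (dirIter QbarIter framePotW dirIter_add dirIter_gaugeDir dirIter_eq_QbarIter_add_gaugeDir
  tangentIter_iff_dirIter_eq_zero)
open NE3SmoothLiftW (framePotW_skew framePotW_add_period)
open NE3HilbertSchmidtTorus
open MinimalActionSandwich (IsMinimiser)
open MinimalActionRate (sfClass)
open NE7MinimiserTensionPairing (critical_of_interior_isMinimiser)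
open NE7ExactCurrent (dAction_add dAction_eq_zero_of_critical isSkewDir_gaugeDir)
open NE3DressedBlockField (cdiv_corner)
open NE3StraightAverageSplit (comp_cdiv_periodic)
open SkeletonLattice (cdiv)

noncomputable section

variable {d : ℕ} {n : Type*} [Fintype n] [DecidableEq n]

/-! ## §1 The exact first variation annihilates `ker QbarIter` at an interior constrained minimiser -/

/-- **`dAction U ψ = 0` WHENEVER `QbarIter L (j+2) U ψ = 0`, AT AN INTERIOR CONSTRAINED MINIMISER.**  For `IsMinimiser d (sfClass d L N ε) L N (j+2) V U`
(`L, N ≥ 1`) with `SmallField U a`, `0 ≤ a < ε∕(L^{j+2})²` (interiority (8), ASSUMED), `LevelSmall d L (j+1) (ε∕(L^{j+2})²)`, and every skew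
`N·L^{j+2}`-periodic direction `ψ` with `QbarIter L (j+2) U ψ = 0`: `dAction U ψ (plaqsOf (periodBox (N·L^{j+2}))) = 0`.  (Structure theorem ⇒
`dirIter ψ` is the coarse gauge direction of `framePotW ψ`; pull the generator back, subtract the fine gauge direction with the same average
(`dirIter_gaugeDir`, `dirIter_add`): the difference is tangent, the minimiser is critical along it, and the action is gauge invariant.) [folklore] -/
theorem dAction_eq_zero_of_QbarIter_eq_zero [Nonempty n] {L N : ℕ} (hL : 1 ≤ L) (hN : 1 ≤ N) {ε a : ℝ} (j : ℕ)
    {V U : Site d → Fin d → (Matrix n n ℂ)ˣ} (hmin : IsMinimiser d (sfClass d L N ε) L N (j + 2) V U)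
    (ha0 : 0 ≤ a) (haε : a < ε / ((L : ℝ) ^ (j + 2)) ^ 2) (hUa : SmallField U a)
    (hls : LevelSmall d L (j + 1) (ε / ((L : ℝ) ^ (j + 2)) ^ 2))
    {ψ : Site d → Fin d → Matrix n n ℂ} (hψs : IsSkewDir ψ) (hψP : IsPeriodicDir ψ ((N * L ^ (j + 2) : ℕ) : ℤ))
    (hψQ : ∀ (z : Site d) (κ : Fin d), QbarIter L (j + 2) U ψ z κ = 0) :
    dAction U ψ (plaqsOf (periodBox (d := d) (N * L ^ (j + 2)))) = 0 := by
  haveI : NeZero N := ⟨by omega⟩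
  set x : ℝ := ε / ((L : ℝ) ^ (j + 2)) ^ 2 with hxdef
  have hM : 1 ≤ L ^ (j + 2) := Nat.one_le_pow _ _ hL
  have hU : IsUnitaryCfg U := hmin.mem.1.1
  have hx : 0 ≤ x := ha0.trans haε.le
  have hUx : SmallField U x := fun y κ κ' hne => (hUa y κ κ' hne).trans haε.le
  -- the period `N·L^{j+2} = tower L N (j+2)`
  have htow : tower L N (j + 2) = N * L ^ (j + 2) := tower_eq L N (j + 2)
  have hUP : IsPeriodicCfg U ((tower L N (j + 1 + 1) : ℕ) : ℤ) := by
    rw [show j + 1 + 1 = j + 2 by ring, htow]; exact hmin.mem.1.2.1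
  have hψP' : IsPeriodicDir ψ ((tower L N (j + 1 + 1) : ℕ) : ℤ) := by
    rw [show j + 1 + 1 = j + 2 by ring, htow]; exact hψP
  -- the structure theorem: `dirIter ψ = QbarIter ψ + gaugeDir (cavgIter) (framePotW ψ) = gaugeDir (cavgIter) (framePotW ψ)`
  have hstruct := dirIter_eq_QbarIter_add_gaugeDir (M := N) hL (j + 1) hU hUP hx hls hUx hψs hψP'
  -- the pulled-back generator
  set lam : Site d → Matrix n n ℂ := fun y => framePotW L (j + 2) U ψ (cdiv (L ^ (j + 2)) y) with hlamdef
  have hlams : ∀ y, lam y ∈ skewAdjoint (Matrix n n ℂ) := fun y => framePotW_skew hL (j + 1) hU hx hls hUx hψs _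
  have hFP := framePotW_add_period L (j + 1) hUP hψP'
  have hlamP : ∀ (y : Site d) (i : Fin d), lam (y + ((tower L N (j + 1 + 1) : ℕ) : ℤ) • e i) = lam y := by
    intro y i
    have hper : ((tower L N (j + 1 + 1) : ℕ) : ℤ) = ((L ^ (j + 2) * N : ℕ) : ℤ) := by
      rw [show j + 1 + 1 = j + 2 by ring, htow, Nat.mul_comm]
    simp only [hlamdef, hper]
    exact comp_cdiv_periodic hM (framePotW L (j + 2) U ψ) (fun z i => hFP z i) y i
  -- its gauge direction has the same linearised average
  have hgauge := dirIter_gaugeDir (M := N) hL (j + 1) hU hUP hx hls hUx hlams hlamP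
  have hpull : (fun y => lam (((L : ℤ) ^ (j + 1 + 1)) • y)) = framePotW L (j + 2) U ψ := by
    funext y
    simp only [hlamdef]
    rw [show ((L : ℤ) ^ (j + 1 + 1)) = ((L ^ (j + 2) : ℕ) : ℤ) by push_cast; ring, cdiv_corner hM]
  rw [hpull] at hgauge
  -- additivity: `dirIter ψ = dirIter (ψ − gaugeDir U lam) + dirIter (gaugeDir U lam)`
  have hadd := dirIter_add hL (j + 1) hU hx hls hUx (fun y μ => ψ y μ - gaugeDir U lam y μ) (gaugeDir U lam)
  have hsplit : (fun y μ => (ψ y μ - gaugeDir U lam y μ) + gaugeDir U lam y μ) = ψ := by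
    funext y μ; exact sub_add_cancel _ _
  rw [hsplit] at hadd
  -- the difference is tangent
  have hzero : dirIter L (j + 1 + 1) U (fun y μ => ψ y μ - gaugeDir U lam y μ) = 0 := by
    funext z κ
    have h1 := congrFun (congrFun hadd z) κ
    have h2 := congrFun (congrFun hstruct z) κ
    have h3 := congrFun (congrFun hgauge z) κ
    have hQ0 : QbarIter L (j + 1 + 1) U ψ z κ = 0 := hψQ z κ
    rw [hQ0, zero_add] at h2
    have key : dirIter L (j + 1 + 1) U (fun y μ => ψ y μ - gaugeDir U lam y μ) z κ + dirIter L (j + 1 + 1) U (gaugeDir U lam) z κ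
        = 0 + dirIter L (j + 1 + 1) U (gaugeDir U lam) z κ := by
      rw [← h1, zero_add, h2, h3]
    exact add_right_cancel key
  have htan : TangentIter L (j + 1) U (fun y μ => ψ y μ - gaugeDir U lam y μ) :=
    (tangentIter_iff_dirIter_eq_zero L (j + 1) U _).mpr hzero
  -- skewness and periodicity of the difference
  have hdls : IsSkewDir (gaugeDir U lam) := isSkewDir_gaugeDir hU hlams
  have hdlP : IsPeriodicDir (gaugeDir U lam) ((N * L ^ (j + 2) : ℕ) : ℤ) := by
    have h := isPeriodicDir_gaugeDir hmin.mem.1.2.1 (lam := lam) (fun y i => by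
      have := hlamP y i; rwa [show j + 1 + 1 = j + 2 by ring, htow] at this)
    exact h
  have hdiffs : IsSkewDir (fun y μ => ψ y μ - gaugeDir U lam y μ) := fun y μ =>
    (skewAdjoint (Matrix n n ℂ)).sub_mem (hψs y μ) (hdls y μ)
  have hdiffP : IsPeriodicDir (fun y μ => ψ y μ - gaugeDir U lam y μ) ((N * L ^ (j + 2) : ℕ) : ℤ) := fun y i μ => by
    show ψ _ μ - gaugeDir U lam _ μ = ψ y μ - gaugeDir U lam y μ
    rw [hψP y i μ, hdlP y i μ]
  -- criticality along the tangent difference, exact vanishing along the gauge part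
  have hcrit := critical_of_interior_isMinimiser hL hN j hmin ha0 haε hUa hls hdiffs hdiffP htan
  have h1 : dAction U (fun y μ => ψ y μ - gaugeDir U lam y μ) (plaqsOf (periodBox (d := d) (N * L ^ (j + 2)))) = 0 :=
    dAction_eq_zero_of_critical hcrit
  have h2 : dAction U (gaugeDir U lam) (plaqsOf (periodBox (d := d) (N * L ^ (j + 2)))) = 0 := dAction_gaugeDir U lam _
  have hψeq : ψ = (fun y μ => ψ y μ - gaugeDir U lam y μ) + gaugeDir U lam := by
    funext y μ; simp
  rw [hψeq, dAction_add, h1, h2, add_zero]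

/-! ## §2 Torus form: the exact current vanishes on the torus 1-forms whose skew extension lies in `ker QbarIter` -/

/-- **`hτS` OF (E3‴) FOR `S = QbarIter` ON THE SKEW FORMS**: for the exact current `τ` of `NE7ExactCurrent` (`τ b = dAction U (extF P b) (period window)`,
`P = N·L^{j+2}`) at an interior `(j+2)`-level constrained minimiser `U` (hypotheses of §1), every torus 1-form `b` with skew extension and
`QbarIter L (j+2) U (extF P b) = 0` has `τ b = 0`. [folklore] -/
theorem exactCurrent_eq_zero_of_QbarIter_eq_zero [Nonempty n] {L N : ℕ} (hL : 1 ≤ L) (hN : 1 ≤ N) {ε a : ℝ} (j : ℕ)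
    {V U : Site d → Fin d → (Matrix n n ℂ)ˣ} (hmin : IsMinimiser d (sfClass d L N ε) L N (j + 2) V U)
    (ha0 : 0 ≤ a) (haε : a < ε / ((L : ℝ) ^ (j + 2)) ^ 2) (hUa : SmallField U a)
    (hls : LevelSmall d L (j + 1) (ε / ((L : ℝ) ^ (j + 2)) ^ 2)) [NeZero (N * L ^ (j + 2))]
    {τ : Form d n (N * L ^ (j + 2)) →L[ℝ] ℝ}
    (hτ : ∀ b : Form d n (N * L ^ (j + 2)), τ b = dAction U (extF (N * L ^ (j + 2)) b) (plaqsOf (periodBox (d := d) (N * L ^ (j + 2)))))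
    {b : Form d n (N * L ^ (j + 2))} (hbs : IsSkewDir (extF (N * L ^ (j + 2)) b))
    (hbQ : ∀ (z : Site d) (κ : Fin d), QbarIter L (j + 2) U (extF (N * L ^ (j + 2)) b) z κ = 0) : τ b = 0 := by
  rw [hτ b]
  exact dAction_eq_zero_of_QbarIter_eq_zero hL hN j hmin ha0 haε hUa hls hbs (isPeriodicDir_extF _ b) hbQ

end

end Summit.QuantumFields.BalabanUV.T4Continuum.NE7ExactCurrentQbarKernel
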